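import Mathlib

/-!
HONEST FRAMING: exact (Metropolis-corrected) sampling algorithms for lattice gauge theory; figures of
merit are autocorrelation/cost numbers at stated couplings and volumes; no continuum-physics claim.

# FisherObstruction — the analytic core of THEOREM F / THEOREM M (THEORY-1.md §13.1, §14):
an analytic logarithmic derivative excludes zeros

Proposed tree path: `Summits/Ventures/LatticeQCDFlow/TrivializingMaps/FisherObstruction.lean` (OURS —
venture work, never `Literature/`). Cell `lqcd-flow` (pub-lqcd), unit `pub-lqcd-theory1-g5`, 2026-08-21.

## What is here (Mathlib only; everything below is PROVED, 0 sorries)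
On a finite lattice with compact gauge group, Lüscher's trivializing-flow action solves
`(Δ + s 𝓥) F_s = S₁ + Ċ(s)` (Lüscher 2010, eqs. (4.5)–(4.10), with `s = tβ`, `𝓥 = ∑ (∂S₁) ∂`), and
integration by parts against the complex weight `e^{-s S₁}` gives the identity
`Ċ(s) · Z(s) = Z'(s)`, `Z(s) = ∫ e^{-s S₁} dU` (THEORY-1 §13.1, THEOREM F; §14, THEOREM M: `Ċ` is
meromorphic on `ℂ` with poles only at the poles of the flow action). THEOREM F says that a zero of the
partition function `Z` (a Fisher zero) is necessarily a singularity of the flow constant `Ċ`, hence of the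
flow action, for EVERY solution of the flow equation. Its analytic content is the following fact, proved here
in full generality (`ne_zero_of_deriv_eq_mul`):

* if `Z` is complex-differentiable on an open preconnected set `U`, `g` is continuous on `U`,
  `Z' = g · Z` on `U`, and `Z a ≠ 0` for some `a ∈ U`, then `Z` has no zero in `U`.

The proof is by the order of vanishing (isolated zeros of analytic functions, Mathlib's
`AnalyticAt.exists_eventuallyEq_pow_smul_nonzero_iff`) and the identity theorem; no ODE theory is used.
Corollaries: `zeroFree_of_flowConstant` (the form used in §13–14: `0 ∈ U`, `Z 0 = 1`) and
`no_continuous_flowConstant_at_zero` (contrapositive: at a Fisher zero no continuous flow constant exists on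
any preconnected open region reaching a point where `Z ≠ 0`). The two-line algebraic skeleton of the §14
dichotomy (`c · Z(s) = 0` from integration by parts) is `dichotomy_of_ibp`.

What is NOT here: the lattice objects themselves (`Δ`, `𝓥`, Haar integration on `G^E`) — the dictionary
`g ↦ Ċ`, `Z ↦ ∫ e^{-sS₁}` is discharged on paper in THEORY-1 §13.1/§14 and, for U(1) in Fourier space, by the
venture files `AbelianRadius.lean` / `AbelianDictionary.lean` (rows R-T1-10/13).

References: M. Lüscher, Commun. Math. Phys. 293 (2010) 899 [arXiv:0907.5491], §4.2–4.3 (bib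
`Luscher2010Trivializing`); THEORY-1.md §13.1 (Theorem F), §14 (Theorem M).
-/

namespace Summit.Ventures.LatticeQCDFlow.TrivializingMaps.Fisher

open Filter Topology Set

/-- **Analytic core of THEOREM F.** If `Z` is complex-differentiable on an open preconnected set `U`,
`g` is continuous on `U`, `deriv Z = g * Z` on `U`, and `Z` does not vanish at some point of `U`, then `Z`
has no zero in `U`. -/
theorem ne_zero_of_deriv_eq_mul {U : Set ℂ} (hUo : IsOpen U) (hUc : IsPreconnected U)
    {Z g : ℂ → ℂ} (hZ : DifferentiableOn ℂ Z U) (hg : ContinuousOn g U)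
    (hode : ∀ s ∈ U, deriv Z s = g s * Z s) {a : ℂ} (ha : a ∈ U) (hZa : Z a ≠ 0) :
    ∀ s ∈ U, Z s ≠ 0 := by
  intro z₀ hz₀ hZz₀
  have hZan : AnalyticOnNhd ℂ Z U := hZ.analyticOnNhd hUo
  have hZat : AnalyticAt ℂ Z z₀ := hZan z₀ hz₀
  rcases hZat.eventually_eq_zero_or_eventually_ne_zero with hzero | hne
  · -- `Z` vanishes identically near `z₀`: identity theorem on the preconnected set `U`.
    have hEq : EqOn Z 0 U := hZan.eqOn_zero_of_preconnected_of_eventuallyEq_zero hUc hz₀ hzero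
    exact hZa (by simpa using hEq ha)
  · -- `z₀` is an isolated zero of finite order `m + 1 ≥ 1`.
    have hnot : ¬ (∀ᶠ z in 𝓝 z₀, Z z = 0) := by
      intro h
      have hF : ∀ᶠ z in 𝓝[≠] z₀, False := by
        filter_upwards [hne, h.filter_mono nhdsWithin_le_nhds] with z h1 h2
        exact h1 h2
      obtain ⟨_, hfalse⟩ := hF.exists
      exact hfalse
    obtain ⟨n, h, hhan, hhz₀, hZeq⟩ := hZat.exists_eventuallyEq_pow_smul_nonzero_iff.mpr hnot
    have hn : n ≠ 0 := by
      rintro rfl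
      have h0 : Z z₀ = (z₀ - z₀) ^ 0 • h z₀ := hZeq.self_of_nhds
      simp at h0
      exact hhz₀ (h0 ▸ hZz₀)
    obtain ⟨m, rfl⟩ := Nat.exists_eq_succ_of_ne_zero hn
    have hZeq' : ∀ᶠ z in 𝓝 z₀, Z z = (z - z₀) ^ (m + 1) * h z := by
      simpa only [smul_eq_mul, Nat.succ_eq_add_one] using hZeq
    -- The auxiliary function `φ`, continuous at `z₀`, vanishing on a punctured neighbourhood, with
    -- `φ z₀ = (m+1) h z₀ ≠ 0` — contradiction.
    set φ : ℂ → ℂ := fun z => ((m : ℂ) + 1) * h z + (z - z₀) * (deriv h z - g z * h z) with hφdef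
    have hφ : ∀ᶠ z in 𝓝[≠] z₀, φ z = 0 := by
      have h1 : ∀ᶠ z in 𝓝 z₀, ∀ᶠ w in 𝓝 z, Z w = (w - z₀) ^ (m + 1) * h w := hZeq'.eventually_nhds
      have h2 : ∀ᶠ z in 𝓝 z₀, AnalyticAt ℂ h z := hhan.eventually_analyticAt
      have h3 : ∀ᶠ z in 𝓝 z₀, z ∈ U := hUo.mem_nhds hz₀
      have h4 : ∀ᶠ z in 𝓝[≠] z₀, z ≠ z₀ := self_mem_nhdsWithin
      filter_upwards [h4, (h1.and (h2.and h3)).filter_mono nhdsWithin_le_nhds] with z hz ⟨hz1, hz2, hz3⟩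
      have hZd : deriv Z z = deriv (fun w => (w - z₀) ^ (m + 1) * h w) z :=
        Filter.EventuallyEq.deriv_eq hz1
      have hhd : HasDerivAt h (deriv h z) z := hz2.differentiableAt.hasDerivAt
      have hpd : HasDerivAt (fun w : ℂ => (w - z₀) ^ (m + 1))
          (((m + 1 : ℕ) : ℂ) * (z - z₀) ^ (m + 1 - 1) * 1) z :=
        ((hasDerivAt_id' z).sub_const z₀).pow (m + 1)
      have hD : deriv (fun w => (w - z₀) ^ (m + 1) * h w) z
          = ((m + 1 : ℕ) : ℂ) * (z - z₀) ^ (m + 1 - 1) * 1 * h z + (z - z₀) ^ (m + 1) * deriv h z :=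
        (hpd.mul hhd).deriv
      have hZz : Z z = (z - z₀) ^ (m + 1) * h z := hz1.self_of_nhds
      have hEq := hode z hz3
      rw [hZd, hD, hZz] at hEq
      simp only [Nat.add_sub_cancel, mul_one] at hEq
      push_cast at hEq
      have key : (z - z₀) ^ m * φ z = 0 := by
        rw [hφdef]
        simp only []
        rw [pow_succ] at hEq
        linear_combination hEq
      exact (mul_eq_zero.mp key).resolve_left (pow_ne_zero m (sub_ne_zero.mpr hz))
    have hφc : ContinuousAt φ z₀ := by
      have c1 : ContinuousAt h z₀ := hhan.continuousAt
      have c2 : ContinuousAt (deriv h) z₀ := hhan.deriv.continuousAt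
      have c3 : ContinuousAt g z₀ := hg.continuousAt (hUo.mem_nhds hz₀)
      have c4 : ContinuousAt (fun z : ℂ => z - z₀) z₀ := continuousAt_id.sub continuousAt_const
      exact (continuousAt_const.mul c1).add (c4.mul (c2.sub (c3.mul c1)))
    have hlim1 : Tendsto φ (𝓝[≠] z₀) (𝓝 (φ z₀)) := hφc.tendsto.mono_left nhdsWithin_le_nhds
    have hlim2 : Tendsto φ (𝓝[≠] z₀) (𝓝 0) :=
      tendsto_const_nhds.congr' (hφ.mono fun z hz => hz.symm)
    have hφ0 : φ z₀ = 0 := tendsto_nhds_unique hlim1 hlim2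
    have hprod : ((m : ℂ) + 1) * h z₀ = 0 := by
      have := hφ0
      simp only [hφdef, sub_self, zero_mul, add_zero] at this
      exact this
    have hm : ((m : ℂ) + 1) ≠ 0 := by exact_mod_cast Nat.succ_ne_zero m
    exact hhz₀ ((mul_eq_zero.mp hprod).resolve_left hm)

/-- THEOREM F, analytic core in the normalisation of THEORY-1 §13–14: a "partition function" `Z` with
`Z 0 = 1`, differentiable on an open preconnected `U ∋ 0`, whose logarithmic derivative is given on `U` by a
continuous "flow constant" `Ċ` (`Z' = Ċ Z`), is zero-free on `U`. Equivalently: the flow constant (hence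
the flow action) of ANY trivializing flow cannot be continued continuously in `s = tβ` through a Fisher zero. -/
theorem zeroFree_of_flowConstant {U : Set ℂ} (hUo : IsOpen U) (hUc : IsPreconnected U) (h0 : (0 : ℂ) ∈ U)
    {Z C : ℂ → ℂ} (hZ : DifferentiableOn ℂ Z U) (hC : ContinuousOn C U) (hZ0 : Z 0 = 1)
    (hflow : ∀ s ∈ U, deriv Z s = C s * Z s) : ∀ s ∈ U, Z s ≠ 0 :=
  ne_zero_of_deriv_eq_mul hUo hUc hZ hC hflow h0 (by simp [hZ0])

/-- Contrapositive form (the OBSTRUCTION): at a zero `z₀ ∈ U` of `Z` there is no continuous function `C` on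
the open preconnected region `U` (containing a point where `Z ≠ 0`) with `Z' = C Z` on `U`. -/
theorem no_continuous_flowConstant_at_zero {U : Set ℂ} (hUo : IsOpen U) (hUc : IsPreconnected U)
    {Z : ℂ → ℂ} (hZ : DifferentiableOn ℂ Z U) {a z₀ : ℂ} (ha : a ∈ U) (hZa : Z a ≠ 0)
    (hz₀ : z₀ ∈ U) (hZz₀ : Z z₀ = 0) :
    ¬ ∃ C : ℂ → ℂ, ContinuousOn C U ∧ ∀ s ∈ U, deriv Z s = C s * Z s := by
  rintro ⟨C, hC, hflow⟩
  exact ne_zero_of_deriv_eq_mul hUo hUc hZ hC hflow ha hZa z₀ hz₀ hZz₀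

/-- The algebraic skeleton of the dichotomy in THEOREM M (§14): if a linear functional `avgW`
(integration against the complex weight `e^{-sS₁}`) annihilates `L g` for every `g` (integration by parts,
`L = Δ + s𝓥 = -e^{sS₁} ∇·(e^{-sS₁} ∇·)`), and `g` is a pencil eigenvector, i.e. `L g = c • 1`, then
`c * Z(s) = 0` with `Z(s) = avgW 1`: either `c = 0` (E-type: `g` is a non-constant zero mode of the weighted
Laplacian) or `Z(s) = 0` (Fisher type). -/
theorem dichotomy_of_ibp {V : Type*} [AddCommGroup V] [Module ℂ V] (L : V →ₗ[ℂ] V) (avgW : V →ₗ[ℂ] ℂ)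
    (one : V) (ibp : ∀ g, avgW (L g) = 0) {g : V} {c : ℂ} (hg : L g = c • one) :
    c = 0 ∨ avgW one = 0 := by
  have h := ibp g
  rw [hg, map_smul, smul_eq_mul] at h
  exact mul_eq_zero.mp h

end Summit.Ventures.LatticeQCDFlow.TrivializingMaps.Fisher
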